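import Mathlib
import HarnessLib
import Summits.ValiantsHypothesis.ValiantsHypothesis.Theorems.LacunarySymmetroidMatrixDescartesReshapingGenericLogConcave

/-!
# K1 + K1′ (val-idea-23 g2) — part 3/4: spread Hankel cuts (K1′)

Section D′ of the original file (verbatim): `sum_pow_ndist_le_finite`, `det_ne_zero_of_abs_decay'`, `incr_gap'`, `det_hankelMinor_ne_zero`,
`hrow_of_spread`, `spreadHankelGeneric_signed`, `spreadHankelGeneric` (K1′: `s`-separated generalized-Hankel cuts of a strongly
`q`-log-concave sequence have full row rank when `4r ≤ q^{s²}`).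

AUTHORSHIP: val-idea-23 g2 (card `reshaping-generic`, crux workfile `Cruxes/MatrixDescartes/ReshapingGenericK1Proof.lean` rev 4,
staged bytes sha12 527413dd06f8); SPLIT into four ≤ 400-line files and landed by val-lit-p7 g14 (landing hand, director R290 (2)(iii) /
desk RULING #329) with no mathematical change: parts `…ReshapingGenericDecay` (A–B), `…ReshapingGenericLogConcave` (C–D),
`…ReshapingGenericHankel` (D′), `…ReshapingGeneric` (K1 positive form, F Kronecker, E K1Check).  VP ≠ VNP is not touched.
-/

set_option linter.dupNamespace false
set_option autoImplicit false

namespace Summit.ValiantsHypothesis.ValiantsHypothesis.Theorems.LacunarySymmetroidMatrixDescartes.ReshapingGeneric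

open Finset Real Matrix

section LogConcave

variable {q : ℝ} {f : ℕ → ℝ}

/-! ## D′. Spread Hankel cuts (the card's K1′): `s`-separated labels, margin `q > 1`, `4r ≤ q^{s²}` -/

/-- Finite form of the off-diagonal geometric row sum: `≤ 2·Σ_{1 ≤ j < r} θ^j`. -/
lemma sum_pow_ndist_le_finite (θ : ℝ) (hθ0 : 0 ≤ θ) (r k : ℕ) (hk : k < r) :
    ∑ n ∈ (range r).erase k, θ ^ Nat.dist k n ≤ 2 * ∑ j ∈ Ico 1 r, θ ^ j := by
  have hsplit : (range r).erase k = (range k) ∪ (Ico (k + 1) r) := by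
    ext n; simp [Finset.mem_Ico]; omega
  have hdisj : Disjoint (range k) (Ico (k + 1) r) := by
    rw [Finset.disjoint_left]; intro n hn; simp [Finset.mem_Ico] at hn ⊢; omega
  rw [hsplit, Finset.sum_union hdisj]
  have hnn : ∀ j ∈ Ico 1 r, j ∉ (∅ : Finset ℕ) → (0 : ℝ) ≤ θ ^ j := fun j _ _ => pow_nonneg hθ0 j
  have hL : ∑ n ∈ range k, θ ^ Nat.dist k n ≤ ∑ j ∈ Ico 1 r, θ ^ j := by
    have h1 : ∑ n ∈ range k, θ ^ Nat.dist k n = ∑ n ∈ range k, θ ^ (k - n) := by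
      apply Finset.sum_congr rfl; intro n hn
      rw [ndist_of_lt (Finset.mem_range.mp hn)]
    have h2 : ∑ n ∈ range k, θ ^ (k - n) = ∑ j ∈ range k, θ ^ (j + 1) := by
      rw [← Finset.sum_range_reflect (fun n => θ ^ (k - n)) k]
      apply Finset.sum_congr rfl; intro j hj
      have := Finset.mem_range.mp hj
      congr 1; omega
    have h3 : ∑ j ∈ range k, θ ^ (j + 1) = ∑ j ∈ Ico 1 (k + 1), θ ^ j := by
      rw [Finset.sum_Ico_eq_sum_range]; apply Finset.sum_congr (by simp) ; intro j _; ring_nf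
    rw [h1, h2, h3]
    apply Finset.sum_le_sum_of_subset_of_nonneg (Finset.Ico_subset_Ico_right (by omega))
    intro j _ _; exact pow_nonneg hθ0 j
  have hR : ∑ n ∈ Ico (k + 1) r, θ ^ Nat.dist k n ≤ ∑ j ∈ Ico 1 r, θ ^ j := by
    have h1 : ∑ n ∈ Ico (k + 1) r, θ ^ Nat.dist k n = ∑ n ∈ Ico (k + 1) r, θ ^ (n - k) := by
      apply Finset.sum_congr rfl; intro n hn
      rw [ndist_of_gt (by simp [Finset.mem_Ico] at hn; omega)]
    have h2 : ∑ n ∈ Ico (k + 1) r, θ ^ (n - k) = ∑ j ∈ Ico 1 (r - k), θ ^ j := by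
      rw [Finset.sum_Ico_eq_sum_range, Finset.sum_Ico_eq_sum_range]
      have : r - k - 1 = r - (k + 1) := by omega
      rw [this]
      apply Finset.sum_congr rfl; intro t _; congr 1; omega
    rw [h1, h2]
    apply Finset.sum_le_sum_of_subset_of_nonneg (Finset.Ico_subset_Ico_right (by omega))
    intro j _ _; exact pow_nonneg hθ0 j
  linarith

/-- Diagonal dominance after decay, finite-sum form: `|N x x| = 1`, `|N x i| ≤ θ^{|x−i|}`, `2·Σ_{1≤j<r} θ^j < 1` ⇒ `det N ≠ 0`. -/
theorem det_ne_zero_of_abs_decay' {r : ℕ} (N : Matrix (Fin r) (Fin r) ℝ) (θ : ℝ) (hθ0 : 0 ≤ θ)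
    (hrow : 2 * ∑ j ∈ Ico 1 r, θ ^ j < 1)
    (hdiag : ∀ x, |N x x| = 1)
    (hoff : ∀ x i, x ≠ i → |N x i| ≤ θ ^ Nat.dist x i) :
    N.det ≠ 0 := by
  apply det_ne_zero_of_sum_row_lt_diag
  intro k
  simp only [Real.norm_eq_abs]
  rw [hdiag]
  have hterm : ∀ j ∈ Finset.univ.erase k, |N k j| ≤ θ ^ Nat.dist (k : ℕ) (j : ℕ) := by
    intro j hj
    have hne : k ≠ j := fun h => by simp [h] at hj
    exact hoff k j hne
  have hsum : ∑ j ∈ Finset.univ.erase k, |N k j|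
      ≤ ∑ j ∈ Finset.univ.erase k, θ ^ Nat.dist (k : ℕ) (j : ℕ) := Finset.sum_le_sum hterm
  have htrans : ∑ j ∈ Finset.univ.erase k, θ ^ Nat.dist (k : ℕ) (j : ℕ)
      = ∑ n ∈ (range r).erase (k : ℕ), θ ^ Nat.dist (k : ℕ) n := by
    set g : ℕ → ℝ := fun n => if n = (k : ℕ) then 0 else θ ^ Nat.dist (k : ℕ) n with hg
    have hgj : ∀ j : Fin r, j ≠ k → g (j : ℕ) = θ ^ Nat.dist (k : ℕ) (j : ℕ) := by
      intro j hj
      have : (j : ℕ) ≠ (k : ℕ) := fun h => hj (Fin.ext h)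
      simp [hg, this]
    calc ∑ j ∈ Finset.univ.erase k, θ ^ Nat.dist (k : ℕ) (j : ℕ)
        = ∑ j ∈ Finset.univ.erase k, g (j : ℕ) :=
          Finset.sum_congr rfl (fun j hj => (hgj j (Finset.ne_of_mem_erase hj)).symm)
      _ = ∑ j : Fin r, g (j : ℕ) - g (k : ℕ) := by rw [Finset.sum_erase_eq_sub (Finset.mem_univ k)]
      _ = ∑ n ∈ range r, g n - g (k : ℕ) := by rw [Fin.sum_univ_eq_sum_range]
      _ = ∑ n ∈ (range r).erase (k : ℕ), g n := by
          rw [Finset.sum_erase_eq_sub (Finset.mem_range.mpr k.isLt)]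
      _ = ∑ n ∈ (range r).erase (k : ℕ), θ ^ Nat.dist (k : ℕ) n :=
          Finset.sum_congr rfl (fun n hn => by
            have : n ≠ (k : ℕ) := Finset.ne_of_mem_erase hn
            simp [hg, this])
  have hgeo := sum_pow_ndist_le_finite θ hθ0 r k k.isLt
  linarith [hsum, htrans ▸ hgeo]

/-- Gap-Monge increments with spreads: row steps `≥ sa` (and `≥ 1`), column steps `≥ sb` ⇒ increment gap `≥ sa·sb·log q`. -/
lemma incr_gap' (hq : 1 ≤ q) (hne : ∀ k, f k ≠ 0)
    (hlc : ∀ k, q * (|f k| * |f (k + 2)|) ≤ f (k + 1) ^ 2) (sa sb : ℕ) (a b : ℕ → ℕ) (j i : ℕ)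
    (ha : a j < a (j + 1)) (hsa : a j + sa ≤ a (j + 1)) (hsb : b (i + 1) + sb ≤ b i) :
    (Real.log (f (a (j + 1) + b i)) - Real.log (f (a j + b i))) + ((sa * sb : ℕ) : ℝ) * Real.log q
      ≤ Real.log (f (a (j + 1) + b (i + 1))) - Real.log (f (a j + b (i + 1))) := by
  have hq0 : 0 < q := by linarith
  have hlq : 0 ≤ Real.log q := Real.log_nonneg hq
  set n := a (j + 1) - a j with hn
  have hn1 : sa ≤ n := by omega
  set g := b i - b (i + 1) with hg
  have hg2 : sb ≤ g := by omega
  have e1 : a (j + 1) + b i = (a j + b i) + n := by omega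
  have e2 : a (j + 1) + b (i + 1) = (a j + b (i + 1)) + n := by omega
  rw [e1, e2, log_telescope f (a j + b i) n, log_telescope f (a j + b (i + 1)) n]
  have hterm : ∀ s ∈ range n, (Real.log (f (a j + b i + s + 1)) - Real.log (f (a j + b i + s))) + (sb : ℝ) * Real.log q
      ≤ (Real.log (f (a j + b (i + 1) + s + 1)) - Real.log (f (a j + b (i + 1) + s))) := by
    intro s _
    have h := logRatio_add_le hq0 hne hlc (a j + b (i + 1) + s) g
    have e3 : a j + b (i + 1) + s + g = a j + b i + s := by omega
    rw [e3] at h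
    have : (sb : ℝ) * Real.log q ≤ (g : ℝ) * Real.log q := by
      have : (sb : ℝ) ≤ (g : ℝ) := by exact_mod_cast hg2
      nlinarith
    linarith
  have hsum := Finset.sum_le_sum hterm
  rw [Finset.sum_add_distrib, Finset.sum_const, Finset.card_range, nsmul_eq_mul] at hsum
  have : ((sa * sb : ℕ) : ℝ) * Real.log q ≤ (n : ℝ) * ((sb : ℝ) * Real.log q) := by
    have h1 : (sa : ℝ) ≤ (n : ℝ) := by exact_mod_cast hn1
    have h2 : (0 : ℝ) ≤ (sb : ℝ) * Real.log q := by positivity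
    push_cast
    nlinarith
  linarith

/-- **K1′ core.**  `f` nowhere zero with margin `q ≥ 1`, rows increasing with steps `≥ sa`, columns decreasing with steps
`≥ sb`, and `θ = exp(−sa·sb·log q / 2)` small enough that `2·Σ_{1≤j<r} θ^j < 1` ⇒ the `r × r` matrix `f (a x + b i)` is
non-singular. -/
theorem det_hankelMinor_ne_zero (hq : 1 ≤ q) (hne : ∀ k, f k ≠ 0)
    (hlc : ∀ k, q * (|f k| * |f (k + 2)|) ≤ f (k + 1) ^ 2) {r : ℕ} (sa sb : ℕ) (a b : ℕ → ℕ)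
    (ha : ∀ j, j + 1 < r → a j < a (j + 1)) (hsa : ∀ j, j + 1 < r → a j + sa ≤ a (j + 1))
    (hsb : ∀ i, i + 1 < r → b (i + 1) + sb ≤ b i)
    (hrow : 2 * ∑ j ∈ Ico 1 r, (Real.exp (-(((sa * sb : ℕ) : ℝ) * Real.log q / 2))) ^ j < 1) :
    (Matrix.of fun x i : Fin r => f (a x + b i)).det ≠ 0 := by
  have hlq0 : 0 ≤ Real.log q := Real.log_nonneg hq
  set L : ℝ := ((sa * sb : ℕ) : ℝ) * Real.log q / 2 with hL
  have hL0 : 0 ≤ L := by positivity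
  set θ : ℝ := Real.exp (-L) with hθ
  set W : ℕ → ℕ → ℝ := fun x i => Real.log (f (a x + b i)) with hW
  have hgap : ∀ j i, j + 1 < r → i + 1 < r →
      W (j + 1) i - W j i + 2 * L ≤ W (j + 1) (i + 1) - W j (i + 1) := by
    intro j i hj hi
    have := incr_gap' hq hne hlc sa sb a b j i (ha j hj) (hsa j hj) (hsb i hi)
    simp only [hW, hL]
    linarith
  obtain ⟨u, v, hdiag, hoff⟩ := decay_of_gapMonge r W L hL0 hgap
  set A : Matrix (Fin r) (Fin r) ℝ := Matrix.of fun x i : Fin r => f (a x + b i) with hAdef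
  set N : Matrix (Fin r) (Fin r) ℝ := Matrix.of fun x i : Fin r => Real.exp (-u x) *
      ((Matrix.of fun x i : Fin r => Real.exp (-v i) * A x i) x i) with hNdef
  have hN : ∀ x i : Fin r, |N x i| = Real.exp (W x i - u x - v i) := by
    intro x i
    simp only [hNdef, hAdef, Matrix.of_apply, abs_mul, abs_of_pos (Real.exp_pos _)]
    rw [← Real.exp_log_eq_abs (hne _),
      show W x i - u x - v i = -u x + (-v i + Real.log (f (a x + b i))) by simp only [hW]; ring,
      Real.exp_add, Real.exp_add]
  have hA : N.det ≠ 0 := det_ne_zero_of_abs_decay' N θ (Real.exp_pos _).le hrow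
    (fun x => by rw [hN, hdiag x x.isLt, Real.exp_zero])
    (by
      intro x i hxi
      rw [hN, hθ, ← Real.exp_nat_mul]
      apply Real.exp_le_exp.mpr
      have h := hoff x i x.isLt i.isLt
      linarith)
  rw [hNdef, Matrix.det_mul_column, Matrix.det_mul_row] at hA
  intro h0
  apply hA
  rw [h0]; ring

/-- The numerical side condition of K1′: `4r ≤ q^{s²}` (`q > 1`) makes `2·Σ_{1≤j<r} θ^j < 1` for `θ = q^{−s²/2}`. -/
lemma hrow_of_spread {q : ℝ} (hq : 1 < q) (r s : ℕ) (hr : (4 * r : ℝ) ≤ q ^ (s * s)) :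
    2 * ∑ j ∈ Ico 1 r, (Real.exp (-(((s * s : ℕ) : ℝ) * Real.log q / 2))) ^ j < 1 := by
  have hq0 : 0 < q := by linarith
  set θ := Real.exp (-(((s * s : ℕ) : ℝ) * Real.log q / 2)) with hθ
  have hθ0 : 0 < θ := Real.exp_pos _
  have hθsq : θ ^ 2 = (q ^ (s * s))⁻¹ := by
    rw [sq, hθ, ← Real.exp_add,
      show -(((s * s : ℕ) : ℝ) * Real.log q / 2) + -(((s * s : ℕ) : ℝ) * Real.log q / 2)
        = -(((s * s : ℕ) : ℝ) * Real.log q) by ring,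
      Real.exp_neg, ← Real.log_pow, Real.exp_log (by positivity)]
  rcases Nat.lt_or_ge r 3 with hr3 | hr3
  · interval_cases r
    · simp
    · simp
    · -- r = 2 : the sum is `θ`, and `θ² ≤ 1/8 < 1/4`
      have hs : ∑ j ∈ Ico 1 2, θ ^ j = θ := by simp
      rw [hs]
      have h8 : θ ^ 2 ≤ 1 / 8 := by
        rw [hθsq, inv_eq_one_div]
        apply one_div_le_one_div_of_le (by norm_num)
        push_cast at hr; linarith
      nlinarith
  · -- r ≥ 3 : `θ² ≤ 1/12 < 1/9`, so `θ < 1/3` and the infinite geometric bound suffices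
    have h12 : θ ^ 2 ≤ 1 / 12 := by
      rw [hθsq, inv_eq_one_div]
      apply one_div_le_one_div_of_le (by norm_num)
      have : (12 : ℝ) ≤ 4 * r := by
        have : (3 : ℝ) ≤ r := by exact_mod_cast hr3
        linarith
      linarith
    have hθ3 : θ < 1 / 3 := by nlinarith
    have hθ1 : θ < 1 := by linarith
    have hgeo : ∑ j ∈ Ico 1 r, θ ^ j ≤ θ ^ 1 / (1 - θ) := geom_sum_Ico_le_of_lt_one hθ0.le hθ1
    rw [pow_one] at hgeo
    have h13 : θ / (1 - θ) < 1 / 2 := by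
      rw [div_lt_iff₀ (by linarith)]; linarith
    linarith

/-- **K1′, signed form (spread Hankel cuts have full row rank).**  With `q > 1`, `f` nowhere zero with
`q·|f k|·|f (k+2)| ≤ f (k+1)²`, row labels `a` and column labels `b` strictly increasing and `s`-separated, `r ≤ c` and
`4r ≤ q^{s²}`, the `r × c` matrix `f (a i + b j)` has rank `r`. -/
theorem spreadHankelGeneric_signed : ∀ q : ℝ, 1 < q → ∀ f : ℕ → ℝ,
    ((∀ k, f k ≠ 0) ∧ ∀ k, q * (|f k| * |f (k + 2)|) ≤ f (k + 1) ^ 2) →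
    ∀ (r c s : ℕ) (a : Fin r → ℕ) (b : Fin c → ℕ), r ≤ c → StrictMono a → StrictMono b →
      (∀ i j : Fin r, i < j → a i + s ≤ a j) → (∀ i j : Fin c, i < j → b i + s ≤ b j) →
      (4 * r : ℝ) ≤ q ^ (s * s) →
      (Matrix.of fun (i : Fin r) (j : Fin c) => f (a i + b j)).rank = r := by
  intro q hq f hf r c s a b hrc ha hb has hbs hr
  set M : Matrix (Fin r) (Fin c) ℝ := Matrix.of fun (i : Fin r) (j : Fin c) => f (a i + b j) with hM
  apply le_antisymm (Matrix.rank_le_height M)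
  -- the `r × r` minor on the first `r` columns, columns reversed
  let a' : ℕ → ℕ := fun n => if h : n < r then a ⟨n, h⟩ else 0
  let b' : ℕ → ℕ := fun n => if h : n < r then b (Fin.castLE hrc (Fin.rev ⟨n, h⟩)) else 0
  let S : Matrix (Fin r) (Fin r) ℝ := M.submatrix id (fun j => Fin.castLE hrc (Fin.rev j))
  have hSeq : S = Matrix.of fun x i : Fin r => f (a' x + b' i) := by
    ext x i
    simp [S, hM, Matrix.submatrix_apply, a', b']
  have hS : S.det ≠ 0 := by
    rw [hSeq]
    refine det_hankelMinor_ne_zero hq.le hf.1 hf.2 s s a' b' ?_ ?_ ?_ (hrow_of_spread hq r s hr)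
    · intro j hj
      have h1 : j < r := by omega
      simp only [a', dif_pos h1, dif_pos hj]
      exact ha (by simp [Fin.lt_def])
    · intro j hj
      have h1 : j < r := by omega
      simp only [a', dif_pos h1, dif_pos hj]
      exact has _ _ (by simp [Fin.lt_def])
    · intro i hi
      have h1 : i < r := by omega
      simp only [b', dif_pos h1, dif_pos hi]
      exact hbs _ _ (by simp [Fin.lt_def, Fin.val_rev]; omega)
  have hSr : S.rank = r := by
    have := Matrix.rank_of_isUnit S ((Matrix.isUnit_iff_isUnit_det S).mpr (isUnit_iff_ne_zero.mpr hS))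
    simpa using this
  calc r = S.rank := hSr.symm
    _ ≤ M.rank := Matrix.rank_submatrix_le M _ _

/-- **K1′ (positive form, as typed on the card: `SpreadHankelGeneric`).** -/
theorem spreadHankelGeneric : ∀ q : ℝ, 1 < q → ∀ f : ℕ → ℝ,
    ((∀ k, 0 < f k) ∧ ∀ k, q * (f k * f (k + 2)) ≤ f (k + 1) ^ 2) →
    ∀ (r c s : ℕ) (a : Fin r → ℕ) (b : Fin c → ℕ), r ≤ c → StrictMono a → StrictMono b →
      (∀ i j : Fin r, i < j → a i + s ≤ a j) → (∀ i j : Fin c, i < j → b i + s ≤ b j) →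
      (4 * r : ℝ) ≤ q ^ (s * s) →
      (Matrix.of fun (i : Fin r) (j : Fin c) => f (a i + b j)).rank = r := by
  intro q hq f hf
  refine spreadHankelGeneric_signed q hq f ⟨fun k => (hf.1 k).ne', fun k => ?_⟩
  rw [abs_of_pos (hf.1 k), abs_of_pos (hf.1 (k + 2))]
  exact hf.2 k

end LogConcave

end Summit.ValiantsHypothesis.ValiantsHypothesis.Theorems.LacunarySymmetroidMatrixDescartes.ReshapingGeneric
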